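import Literature.Computability.AlgebraicComplexity.BorderRankMatMulThreeCover
import HarnessLib

/-!
# Borel-fixed `(110)`-candidates of `⟨3,3,3⟩`, III: the profile constraints

Topic `Literature/Computability/AlgebraicComplexity`. Sequel of `BorderRankMatMulThreeCover.lean`:
the profile `(rootSet E, δ(E), d(E))` of an admissible subspace (`IsAdmissible`,
`BorderRankMatMulThreeBlocks.lean`) satisfies the DECIDABLE constraints that cut the Borel-fixed
candidates of Conner–Harper–Landsberg 2023, §6 down to a finite list:

* `MatMul3.BlockOK R δ` — per block: off-diagonal positions, upper-set closure under the two
  raising rules, a negative root forces the positive root and a coroot (`δ ≥ 1`; both negative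
  simple roots force `δ = 2`), a missing simple positive root cuts the diagonal (`δ ≤ 1`; both
  missing force `δ = 0`), `δ ≤ 2` — with `MatMul3.IsAdmissible.blockOK`;
* `MatMul3.IsAdmissible.δOf_mono_row/col` (with `rootSet_mono_row/col` of the Blocks file) —
  monotone along block rows and columns;
* `MatMul3.sum_card_add_finrank_le`, `MatMul3.IsAdmissible.budget` — the root units and diagonal
  parts are independent, so `∑_{jk} (|R_{jk}| + δ_{jk}) ≤ dim E - 9 ≤ 7`.

## References

* A. Conner, A. Harper, J. M. Landsberg, *New lower bounds for matrix multiplication and `det₃`*,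
  Forum Math. Pi 11 (2023) e17, arXiv:1911.07981 — §2.5, §6. [ConnerHarperLandsberg2023]
-/

noncomputable section

open scoped BigOperators

namespace Literature.Computability.AlgebraicComplexity

namespace BorderApolarity

namespace MatMul3

universe u

variable {K : Type u} [Field K]

/-! ## The profile constraints -/

/-- **The decidable constraints on one block** of a Borel-fixed candidate: off-diagonal root
positions, upper-set closure under the raising rules, a negative root forces the positive root and
a coroot (`δ ≥ 1`; both negative simple roots force `δ = 2`), a missing simple positive root cuts
the diagonal (`δ ≤ 1`, both missing force `δ = 0`), `δ ≤ 2`. [cite: ConnerHarperLandsberg2023, §2.5] -/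
def BlockOK (R : Finset (Fin 3 × Fin 3)) (δ : ℕ) : Prop :=
  (∀ ii' ∈ R, ii'.1 ≠ ii'.2) ∧
  (∀ p q : Fin 3, p < q → ∀ i' : Fin 3, (q, i') ∈ R → i' ≠ p → (p, i') ∈ R) ∧
  (∀ p q : Fin 3, p < q → ∀ i : Fin 3, (i, p) ∈ R → i ≠ q → (i, q) ∈ R) ∧
  (∀ p q : Fin 3, p < q → (q, p) ∈ R → (p, q) ∈ R ∧ 1 ≤ δ) ∧
  (((1 : Fin 3), (0 : Fin 3)) ∈ R → ((2 : Fin 3), (1 : Fin 3)) ∈ R → 2 ≤ δ) ∧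
  (∀ p q : Fin 3, p < q → (p, q) ∉ R → δ ≤ 1) ∧
  (((0 : Fin 3), (1 : Fin 3)) ∉ R → ((1 : Fin 3), (2 : Fin 3)) ∉ R → δ = 0) ∧
  δ ≤ 2

set_option synthInstance.maxSize 1024 in
/-- `BlockOK` is decidable (the conjunction of eight decidable clauses exceeds the default instance
size bound, whence the option). [folklore] -/
instance (R : Finset (Fin 3 × Fin 3)) (δ : ℕ) : Decidable (BlockOK R δ) := by
  unfold BlockOK; infer_instance

section Constraints

variable [CharZero K] {E : Submodule K (I9' × I9' → K)} (hE : IsAdmissible E)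
include hE

omit [CharZero K] in
/-- `dim diagSub ≥ 1` (it contains the constants). [folklore] -/
theorem IsAdmissible.one_le_finrank_diagSub (j k : Fin 3) : 1 ≤ Module.finrank K (diagSub E j k) := by
  have h := Submodule.finrank_mono (Submodule.span_le.2
    (show ({fun _ => (1 : K)} : Set (Fin 3 → K)) ⊆ diagSub E j k by simpa using hE.one_mem_diagSub j k))
  rwa [finrank_span_one] at h

omit [CharZero K] hE in
/-- `dim diagSub ≤ 3`. [folklore] -/
theorem finrank_diagSub_le (E : Submodule K (I9' × I9' → K)) (j k : Fin 3) :
    Module.finrank K (diagSub E j k) ≤ 3 := by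
  have := Submodule.finrank_le (diagSub E j k)
  simpa using this

omit [CharZero K] in
/-- A missing positive root `(p,q)` cuts the diagonal to the plane `d_p = d_q`: `dim ≤ 2`.
[cite: ConnerHarperLandsberg2023, §2.5] -/
theorem IsAdmissible.finrank_diagSub_le_two {p q : Fin 3} (hpq : p < q) {j k : Fin 3}
    (hR : (p, q) ∉ rootSet E j k) : Module.finrank K (diagSub E j k) ≤ 2 := by
  -- `diagSub ≤ ker (d ↦ d p - d q)`, a proper subspace
  let f : (Fin 3 → K) →ₗ[K] K :=
    { toFun := fun d => d p - d q
      map_add' := fun x y => by simp only [Pi.add_apply]; ring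
      map_smul' := fun c x => by simp only [Pi.smul_apply, smul_eq_mul, RingHom.id_apply]; ring }
  have hle : diagSub E j k ≤ LinearMap.ker f := fun d hd => by
    simp only [LinearMap.mem_ker, f, LinearMap.coe_mk, AddHom.coe_mk, sub_eq_zero]
    exact hE.apply_eq_of_not_mem_rootSet hpq hR hd
  have hker : Module.finrank K (LinearMap.ker f) + 1 = 3 := by
    have hr : Module.finrank K (LinearMap.range f) = 1 := by
      have hsurj : Function.Surjective f := fun c => ⟨Pi.single p c, by simp [f, hpq.ne']⟩
      rw [LinearMap.range_eq_top.2 hsurj, finrank_top, Module.finrank_self]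
    have h := LinearMap.finrank_range_add_finrank_ker f
    rw [hr] at h
    have h3 : Module.finrank K (Fin 3 → K) = 3 := by simp
    omega
  have := Submodule.finrank_mono hle
  omega

omit [CharZero K] in
/-- Both simple positive roots missing cut the diagonal to the constants: `dim ≤ 1`.
[cite: ConnerHarperLandsberg2023, §2.5] -/
theorem IsAdmissible.finrank_diagSub_le_one {j k : Fin 3}
    (h01 : ((0 : Fin 3), (1 : Fin 3)) ∉ rootSet E j k) (h12 : ((1 : Fin 3), (2 : Fin 3)) ∉ rootSet E j k) :
    Module.finrank K (diagSub E j k) ≤ 1 := by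
  have hle : diagSub E j k ≤ Submodule.span K ({fun _ => (1 : K)} : Set (Fin 3 → K)) := by
    intro d hd
    have e01 := hE.apply_eq_of_not_mem_rootSet (p := 0) (q := 1) (by decide) h01 hd
    have e12 := hE.apply_eq_of_not_mem_rootSet (p := 1) (q := 2) (by decide) h12 hd
    rw [Submodule.mem_span_singleton]
    refine ⟨d 0, funext fun i => ?_⟩
    fin_cases i <;> simp [e01, e12]
  have := Submodule.finrank_mono hle
  rwa [finrank_span_one] at this

/-- A negative root gives `dim diagSub ≥ 2` (constants and the coroot).
[cite: ConnerHarperLandsberg2023, §2.5] -/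
theorem IsAdmissible.two_le_finrank_diagSub {p q : Fin 3} (hpq : p < q) {j k : Fin 3}
    (hR : (q, p) ∈ rootSet E j k) : 2 ≤ Module.finrank K (diagSub E j k) := by
  have hv := hE.coroot_mem hpq hR
  have hv1 : (Pi.single p (1 : K) - Pi.single q 1 : Fin 3 → K) ∉
      Submodule.span K ({fun _ => (1 : K)} : Set (Fin 3 → K)) := by
    intro hmem
    rw [Submodule.mem_span_singleton] at hmem
    obtain ⟨c, hc⟩ := hmem
    have ep := congr_fun hc p
    have eq := congr_fun hc q
    simp [hpq.ne, hpq.ne'] at ep eq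
    rw [ep] at eq
    norm_num at eq
  have hle : Submodule.span K ({(fun _ => (1 : K)), Pi.single p (1 : K) - Pi.single q 1} :
      Set (Fin 3 → K)) ≤ diagSub E j k :=
    Submodule.span_le.2 (by
      rintro w (rfl | rfl)
      · exact hE.one_mem_diagSub j k
      · exact hv)
  have := Submodule.finrank_mono hle
  rwa [finrank_span_pair hv1] at this

/-- Both negative simple roots give all diagonals: `dim diagSub = 3`.
[cite: ConnerHarperLandsberg2023, §2.5] -/
theorem IsAdmissible.three_le_finrank_diagSub {j k : Fin 3}
    (h10 : ((1 : Fin 3), (0 : Fin 3)) ∈ rootSet E j k) (h21 : ((2 : Fin 3), (1 : Fin 3)) ∈ rootSet E j k) :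
    3 ≤ Module.finrank K (diagSub E j k) := by
  have hv := hE.coroot_mem (p := 0) (q := 1) (by decide) h10
  have hw := hE.coroot_mem (p := 1) (q := 2) (by decide) h21
  have h1 := hE.one_mem_diagSub j k
  -- `3 e₀ = 1 + 2(e₀ - e₁) + (e₁ - e₂)`, `e₁ = e₀ - (e₀ - e₁)`, `e₂ = e₁ - (e₁ - e₂)`
  have he0 : (Pi.single 0 1 : Fin 3 → K) ∈ diagSub E j k := by
    have : (Pi.single (0 : Fin 3) (1 : K) : Fin 3 → K) = (3 : K)⁻¹ • ((fun _ => (1 : K)) +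
        (2 : K) • (Pi.single 0 1 - Pi.single 1 1) + (Pi.single 1 1 - Pi.single 2 1)) := by
      funext i
      fin_cases i <;> simp <;> norm_num
    rw [this]
    exact Submodule.smul_mem _ _ (Submodule.add_mem _ (Submodule.add_mem _ h1
      (Submodule.smul_mem _ _ hv)) hw)
  have he1 : (Pi.single 1 1 : Fin 3 → K) ∈ diagSub E j k := by
    have : (Pi.single (1 : Fin 3) (1 : K) : Fin 3 → K) = Pi.single 0 1 - (Pi.single 0 1 - Pi.single 1 1) := by
      abel
    rw [this]
    exact Submodule.sub_mem _ he0 hv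
  have he2 : (Pi.single 2 1 : Fin 3 → K) ∈ diagSub E j k := by
    have : (Pi.single (2 : Fin 3) (1 : K) : Fin 3 → K) = Pi.single 1 1 - (Pi.single 1 1 - Pi.single 2 1) := by
      abel
    rw [this]
    exact Submodule.sub_mem _ he1 hw
  have htop : (⊤ : Submodule K (Fin 3 → K)) ≤ diagSub E j k := by
    rw [← (Pi.basisFun K (Fin 3)).span_eq, Submodule.span_le]
    rintro _ ⟨i, rfl⟩
    rw [Pi.basisFun_apply]
    fin_cases i
    · exact he0
    · exact he1
    · exact he2
  have := Submodule.finrank_mono htop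
  rw [finrank_top] at this
  simpa using this

/-- **The profile of an admissible `E` satisfies the block constraints.**
[cite: ConnerHarperLandsberg2023, §2.5 and §6] -/
theorem IsAdmissible.blockOK (jk : Fin 3 × Fin 3) : BlockOK (rootSet E jk.1 jk.2) (δOf E jk) := by
  have h1 := hE.one_le_finrank_diagSub jk.1 jk.2
  have h3 := finrank_diagSub_le E jk.1 jk.2
  refine ⟨fun ii' h => (mem_rootSet.1 (show (ii'.1, ii'.2) ∈ _ from h)).1, fun p q hpq i' h hi' =>
    hE.mem_rootSet_left hpq h hi', fun p q hpq i h hi => hE.mem_rootSet_right hpq h hi,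
    fun p q hpq h => ⟨?_, ?_⟩, fun h10 h21 => ?_, fun p q hpq h => ?_, fun h01 h12 => ?_, ?_⟩
  · -- a negative root forces the positive root: the coroot has distinct entries at `p`, `q`
    by_contra hnot
    have hc := hE.apply_eq_of_not_mem_rootSet hpq hnot (hE.coroot_mem hpq h)
    simp [hpq.ne, hpq.ne'] at hc
    norm_num at hc
  · have := hE.two_le_finrank_diagSub hpq h
    simp only [δOf]; omega
  · have := hE.three_le_finrank_diagSub h10 h21
    simp only [δOf]; omega
  · have := hE.finrank_diagSub_le_two hpq h
    simp only [δOf]; omega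
  · have := hE.finrank_diagSub_le_one h01 h12
    simp only [δOf]; omega
  · simp only [δOf]; omega

omit [CharZero K] in
/-- `δ` decreases along block rows. [cite: ConnerHarperLandsberg2023, §2.5] -/
theorem IsAdmissible.δOf_mono_row {p q : Fin 3} (hpq : p < q) (k : Fin 3) :
    δOf E (q, k) ≤ δOf E (p, k) := by
  simp only [δOf]
  have := Submodule.finrank_mono (hE.diagSub_mono_row hpq k)
  omega

omit [CharZero K] in
/-- `δ` decreases along block columns. [cite: ConnerHarperLandsberg2023, §2.5] -/
theorem IsAdmissible.δOf_mono_col {p q : Fin 3} (hpq : p < q) (j : Fin 3) :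
    δOf E (j, q) ≤ δOf E (j, p) := by
  simp only [δOf]
  have := Submodule.finrank_mono (hE.diagSub_mono_col hpq j)
  omega

omit [CharZero K] hE in
/-- **Dimension count**: the root units and the diagonal parts of a subspace `E` are independent
inside `E`, so `∑_{jk} (|R_{jk}| + dim diagSub_{jk}) ≤ dim E`. [cite: ConnerHarperLandsberg2023, §6] -/
theorem sum_card_add_finrank_le (E : Submodule K (I9' × I9' → K)) :
    ∑ jk : Fin 3 × Fin 3, ((rootSet E jk.1 jk.2).card + Module.finrank K (diagSub E jk.1 jk.2)) ≤
      Module.finrank K E := by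
  classical
  -- the parametrising space and the map
  let S : Type := Σ jk : Fin 3 × Fin 3, (rootSet E jk.1 jk.2 : Set (Fin 3 × Fin 3))
  let V : Type u := (Π jk : Fin 3 × Fin 3, diagSub E jk.1 jk.2) × (S → K)
  let Φ₁ : (Π jk : Fin 3 × Fin 3, diagSub E jk.1 jk.2) →ₗ[K] (I9' × I9' → K) :=
    ∑ jk : Fin 3 × Fin 3, (diagVecLin jk.1 jk.2).comp ((diagSub E jk.1 jk.2).subtype.comp
      (LinearMap.proj jk))
  let Φ₂ : (S → K) →ₗ[K] (I9' × I9' → K) :=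
    ∑ s : S, (LinearMap.proj s : (S → K) →ₗ[K] K).smulRight (unitVec (K := K) s.1.1 s.1.2 s.2.1.1 s.2.1.2)
  let Φ : V →ₗ[K] (I9' × I9' → K) := Φ₁.comp (LinearMap.fst K _ _) + Φ₂.comp (LinearMap.snd K _ _)
  have hΦapply : ∀ fg : V, Φ fg = (∑ jk : Fin 3 × Fin 3, diagVec jk.1 jk.2 (fg.1 jk : Fin 3 → K)) +
      ∑ s : S, fg.2 s • unitVec (K := K) s.1.1 s.1.2 s.2.1.1 s.2.1.2 := by
    intro fg
    simp only [Φ, Φ₁, Φ₂, LinearMap.add_apply, LinearMap.comp_apply, LinearMap.sum_apply,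
      LinearMap.proj_apply, Submodule.subtype_apply, LinearMap.smulRight_apply]
    rfl
  -- its image lies in `E`
  have hrange : ∀ v, Φ v ∈ E := by
    intro fg
    rw [hΦapply]
    refine Submodule.add_mem _ (Submodule.sum_mem _ fun jk _ => (fg.1 jk).2)
      (Submodule.sum_mem _ fun s _ => Submodule.smul_mem _ _ ?_)
    have hs := s.2.2
    exact (mem_rootSet.1 hs).2
  -- values at block coordinates
  have hval : ∀ (fg : V) (j k i i' : Fin 3), Φ fg (blk j k i i') =
      (if i = i' then (fg.1 (j, k) : Fin 3 → K) i else 0) +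
        ∑ s : S, if s.1 = (j, k) ∧ s.2.1 = (i, i') then fg.2 s else 0 := by
    intro fg j k i i'
    rw [hΦapply]
    simp only [Pi.add_apply, Finset.sum_apply, Pi.smul_apply, smul_eq_mul, diagVec_blk, unitVec_blk]
    congr 1
    · rw [Finset.sum_eq_single (j, k)]
      · by_cases h : i = i' <;> simp [h]
      · rintro ⟨j', k'⟩ _ hne
        rw [if_neg]
        rintro ⟨h1, h2, -⟩
        exact hne (Prod.ext h2.symm h1.symm)
      · intro h; exact absurd (Finset.mem_univ _) h
    · refine Finset.sum_congr rfl fun s _ => ?_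
      obtain ⟨⟨j', k'⟩, ⟨⟨i₁, i₁'⟩, hs⟩⟩ := s
      simp only [Prod.mk.injEq]
      by_cases h : j = j' ∧ k = k' ∧ i = i₁ ∧ i' = i₁'
      · rw [if_pos h, if_pos ⟨⟨h.1.symm, h.2.1.symm⟩, h.2.2.1.symm, h.2.2.2.symm⟩, mul_one]
      · rw [if_neg h, if_neg (fun h' => h ⟨h'.1.1.symm, h'.1.2.symm, h'.2.1.symm, h'.2.2.symm⟩),
          mul_zero]
  -- injectivity
  have hinj : Function.Injective Φ := by
    rw [← LinearMap.ker_eq_bot, Submodule.eq_bot_iff]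
    intro fg hfg
    rw [LinearMap.mem_ker] at hfg
    have hf : fg.1 = 0 := by
      funext jk
      apply Subtype.ext
      funext i
      have h := hval fg jk.1 jk.2 i i
      rw [hfg, Pi.zero_apply, if_pos rfl, Finset.sum_eq_zero, add_zero] at h
      · exact h.symm
      · rintro ⟨jk', ⟨⟨i₁, i₁'⟩, hs⟩⟩ _
        rw [if_neg]
        rintro ⟨-, h2⟩
        simp only [Prod.mk.injEq] at h2
        exact (mem_rootSet.1 hs).1 (h2.1.trans h2.2.symm)
    have hg : fg.2 = 0 := by
      funext s
      obtain ⟨⟨j, k⟩, ⟨⟨i, i'⟩, hs⟩⟩ := s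
      have hii' := (mem_rootSet.1 hs).1
      have h := hval fg j k i i'
      rw [hfg, Pi.zero_apply, if_neg hii', zero_add,
        Finset.sum_eq_single (⟨(j, k), ⟨(i, i'), hs⟩⟩ : S)] at h
      · simpa using h.symm
      · rintro ⟨jk', ⟨ii', hs'⟩⟩ _ hne
        rw [if_neg]
        rintro ⟨h1, h2⟩
        apply hne
        subst h1
        simp only at h2
        subst h2
        rfl
      · intro h; exact absurd (Finset.mem_univ _) h
    exact Prod.ext hf hg
  -- count
  have hΦ : Module.finrank K V ≤ Module.finrank K E := by
    have h1 := LinearMap.finrank_range_of_inj hinj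
    have h2 : LinearMap.range Φ ≤ E := by rintro _ ⟨v, rfl⟩; exact hrange v
    rw [← h1]
    exact Submodule.finrank_mono h2
  have hV : Module.finrank K V = ∑ jk : Fin 3 × Fin 3, ((rootSet E jk.1 jk.2).card +
      Module.finrank K (diagSub E jk.1 jk.2)) := by
    simp only [V, S]
    rw [Module.finrank_prod, Module.finrank_fintype_fun_eq_card, Module.finrank_pi_fintype,
      Fintype.card_sigma]
    simp only [Finset.coe_sort_coe, Fintype.card_coe, Finset.sum_add_distrib]
    ring
  omega

omit [CharZero K] in
/-- **Budget**: `∑_{jk} (|R_{jk}| + δ_{jk}) ≤ 7` for the profile of an admissible `E`.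
[cite: ConnerHarperLandsberg2023, §6] -/
theorem IsAdmissible.budget :
    ∑ jk : Fin 3 × Fin 3, ((rootSet E jk.1 jk.2).card + δOf E jk) ≤ 7 := by
  have h := sum_card_add_finrank_le E
  have h16 := hE.finrank_le
  have hδ : ∀ jk : Fin 3 × Fin 3, (rootSet E jk.1 jk.2).card + Module.finrank K (diagSub E jk.1 jk.2) =
      ((rootSet E jk.1 jk.2).card + δOf E jk) + 1 := by
    intro jk
    have := hE.one_le_finrank_diagSub jk.1 jk.2
    simp only [δOf]
    omega
  simp only [hδ, Finset.sum_add_distrib, Finset.sum_const, Finset.card_univ, Fintype.card_prod,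
    Fintype.card_fin, smul_eq_mul] at h
  simp only [Finset.sum_add_distrib]
  omega

end Constraints

end MatMul3

end BorderApolarity

end Literature.Computability.AlgebraicComplexity

end
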